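import Literature.NumberTheory.Transcendental.QuadraticRelationsLogarithmsSec6Final
import HarnessLib

/-!
# Roy–Waldschmidt 1997: Théorème 5.1 in subspace form, and Théorème 0.2 from it

D. Roy, M. Waldschmidt, Ann. Sci. ÉNS (4) 30 (1997) 753–796, Théorème 5.1, p. 779.  The theorem
asserts the existence of a connected algebraic subgroup `L ≠ G` of `G = 𝐆_a^{d₀} × 𝐆_m^{d₁}`
defined over `K` such that, with `d' = dim(G/L)`, `d₀' = dim(G₀/π₀(L))`, `d₁' = dim(G₁/π₁(L))`,
`ℓ₀' = dim_K((W + T_L(K))/T_L(K))`, `λ' = rang((Γ + L(K))/L(K))`, `λ_a' = rang((Γ_a + L(K))/L(K))`,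
(5.1) holds for all `0 < ε ≤ (2d(d+λ)+1)⁻¹`.  Connected algebraic subgroups of `G` defined over
`K` are the `L = L₀ × L₁` with `T_{L₀} = T₀ ⊆ ℂ^{d₀}` a subspace defined over `K` and `L₁` a
subtorus, `T_{L₁} = T₁ ⊆ ℂ^{d₁}` a subspace defined over `ℚ`; `L ≠ G ⟺ (T₀, T₁) ≠ (ℂ^{d₀}, ℂ^{d₁})`;
`exp_G⁻¹(L(ℂ)) = T₀ × (T₁ + 2πiℤ^{d₁}) = (T₀ × T₁) + (0 × 2πiℤ^{d₁})`; hence, with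
`Γ = exp_G(Y) ≅ Y/(Y ∩ Ω)`, `Ω = 0 × 2πiℤ^{d₁}`:
`d₀' = d₀ - dim T₀`, `d₁' = d₁ - dim T₁`, `d' = d₀' + d₁'`, `ℓ₀' = dim_K W - dim_K(W ∩ (T₀ × T₁))`,
`λ' = rang Y - rang(Y ∩ ((T₀ × T₁) + Ω))`, `λ_a' = rang Y_a - rang(Y_a ∩ ((T₀ × T₁) + Ω))`.
This gives the **subspace form** of Théorème 5.1 used below (hypothesis `h51sub`), in which every
quantity is the printed one under this dictionary and no auxiliary map is chosen.

* `h51_of_subspaceForm` — PROVED: the subspace form implies the tangent-map form `h51` of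
  `…Sec6IVa.lean` (take `g = g₀ × g₁`, `g₀` the `K`-quotient by `T₀`, `g₁` the saturated integral
  quotient by `T₁`; then `dim_K g(W) = ℓ₀'`, `rang g(Y) - rang(g(Y) ∩ Ω') = λ'`, etc.).
* `royWaldschmidt_quadratic_thm_0_2_of_thm_5_1_subspaceForm` — **the named fact from Théorème 5.1
  in subspace form** (through `royWaldschmidt_quadratic_thm_0_2_of_thm_5_1` of `…Sec6Final.lean`).

No definitions, no named facts.

## References

* [RoyWaldschmidt1997ENS] D. Roy, M. Waldschmidt, Ann. Sci. ÉNS (4) 30 (1997) 753–796,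
  Théorème 5.1 p. 779; §6 (iv) (a) pp. 788–789.
-/

noncomputable section

open Complex IntermediateField Module Submodule

namespace Literature.NumberTheory.Transcendental

namespace RoyWaldschmidt1997

open LiePresentation

variable {K : IntermediateField ℚ ℂ}

/-! ### The saturated integral quotient -/

set_option maxHeartbeats 800000 in
/-- **Saturated integral quotient.**  For `R ⊆ ℂⁿ` defined over `ℚ` of dimension `k`: a surjective
linear `g₁ : ℂⁿ → ℂ^{n-k}` with kernel `R`, given by an integer matrix, such that
`g₁⁻¹(2πiℤ^{n-k}) = R + 2πiℤⁿ`. [folklore] -/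
theorem exists_intQuot_sat {n : ℕ} (R : Submodule ℂ (Fin n → ℂ)) (hR : IsKRational ℚ R) :
    ∃ (k : ℕ) (g₁ : (Fin n → ℂ) →ₗ[ℂ] (Fin (n - k) → ℂ)) (C : Matrix (Fin (n - k)) (Fin n) ℤ),
      Function.Surjective g₁ ∧ LinearMap.ker g₁ = R ∧ (∀ v l, g₁ v l = ∑ j, (C l j : ℂ) * v j) ∧
      Module.finrank ℂ R = k ∧ k ≤ n ∧
      (∀ x : Fin n → ℂ, (∀ l, ∃ m : ℤ, g₁ x l = m * (2 * Real.pi * I)) →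
        ∃ (z : Fin n → ℤ) (t : Fin n → ℂ), t ∈ R ∧ x = (fun j => (z j : ℂ) * (2 * Real.pi * I)) + t) := by
  classical
  obtain ⟨k, A, B, C, D, hkm, -, hCD, hCA, -, hsum, hfr, hS⟩ := exists_integral_frame R hR
  set g₁ := (C.map (Int.castRingHom ℂ)).mulVecLin with hg₁
  have hright : g₁.comp (D.map (Int.castRingHom ℂ)).mulVecLin = LinearMap.id := by
    rw [hg₁, mulVecLin_intCast_comp, hCD]; simp
  have hsurj : Function.Surjective g₁ := by
    intro w
    refine ⟨(D.map (Int.castRingHom ℂ)).mulVecLin w, ?_⟩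
    have := LinearMap.congr_fun hright w
    rwa [LinearMap.comp_apply] at this
  have hcols : Set.range (A.map (Int.castRingHom ℂ)).col = Set.range fun j : Fin k => fun i => ((A i j : ℤ) : ℂ) := by
    ext w; simp only [Set.mem_range]
    constructor <;> rintro ⟨j, rfl⟩ <;> exact ⟨j, by funext i; simp [Matrix.map_apply]⟩
  have hAf : LinearMap.range (A.map (Int.castRingHom ℂ)).mulVecLin = R := by
    rw [Matrix.range_mulVecLin, hcols, hS]
  -- the decomposition `x = A (B x) + D (C x)`
  have hdec : ∀ x : Fin n → ℂ, x = (A.map (Int.castRingHom ℂ)).mulVecLin ((B.map (Int.castRingHom ℂ)).mulVecLin x) +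
      (D.map (Int.castRingHom ℂ)).mulVecLin (g₁ x) := by
    intro x
    have h1 : ((A * B + D * C).map (Int.castRingHom ℂ)).mulVecLin x = x := by rw [hsum]; simp
    rw [Matrix.map_add (⇑(Int.castRingHom ℂ)) (fun a₁ a₂ => map_add _ a₁ a₂), Matrix.mulVecLin_add,
      LinearMap.add_apply, ← mulVecLin_intCast_comp, ← mulVecLin_intCast_comp, LinearMap.comp_apply,
      LinearMap.comp_apply] at h1
    rw [← hg₁] at h1
    exact h1.symm
  have hker : LinearMap.ker g₁ = R := by
    refine le_antisymm ?_ ?_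
    · intro x hx
      rw [LinearMap.mem_ker] at hx
      rw [← hAf, hdec x, hx, map_zero, add_zero]
      exact ⟨_, rfl⟩
    · rw [← hAf]
      rintro _ ⟨v, rfl⟩
      rw [LinearMap.mem_ker, hg₁, ← LinearMap.comp_apply, mulVecLin_intCast_comp, hCA]
      simp
  refine ⟨k, g₁, C, hsurj, hker, fun v l => ?_, hfr, hkm, fun x hx => ?_⟩
  · rw [hg₁, mulVecLin_intCast_apply]
  · choose m hm using hx
    refine ⟨D.mulVec m, (A.map (Int.castRingHom ℂ)).mulVecLin ((B.map (Int.castRingHom ℂ)).mulVecLin x),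
      by rw [← hAf]; exact ⟨_, rfl⟩, ?_⟩
    conv_lhs => rw [hdec x]
    rw [add_comm]
    congr 1
    have hgx : g₁ x = fun l => (m l : ℂ) * (2 * Real.pi * I) := funext hm
    rw [hgx]
    funext j
    rw [mulVecLin_intCast_apply]
    simp only [Matrix.mulVec, dotProduct, Int.cast_sum, Int.cast_mul, Finset.sum_mul]
    refine Finset.sum_congr rfl fun l _ => by ring

/-! ### From the subspace form to the tangent-map form -/

set_option maxHeartbeats 1600000 in
/-- **Théorème 5.1, subspace form ⟹ tangent-map form** (the dictionary of the module docstring: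
`g = g₀ × g₁` the quotient by `T₀ × T₁`; `d₀' = d₀ - dim T₀`, `d₁' = d₁ - dim T₁`,
`dim_K g(W) = dim_K W - dim_K(W ∩ (T₀ × T₁))`,
`rang g(Y) - rang(g(Y) ∩ Ω') = rang Y - rang(Y ∩ ((T₀ × T₁) + Ω))`, and the same for `Y_a`).
[cite: RoyWaldschmidt1997ENS, Théorème 5.1 p. 779; §6 (iv) (a) p. 789] -/
theorem h51_of_subspaceForm (X : RWObj K) (hsub :
    ∃ (T₀ : Submodule ℂ (Fin X.d₀ → ℂ)) (T₁ : Submodule ℂ (Fin X.d₁ → ℂ)),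
      IsKRational K T₀ ∧ IsKRational ℚ T₁ ∧ (T₀ ≠ ⊤ ∨ T₁ ≠ ⊤) ∧
      ∀ ε : ℝ, 0 < ε → ε ≤ 1 / (2 * ((X.d₀ : ℝ) + X.d₁) * (((X.d₀ : ℝ) + X.d₁) + ((X.ell₁ : ℝ) - X.kap)) + 1) →
        ((((X.d₀ : ℝ) + X.d₁) - 2 * X.nn) + ε * ((X.nn : ℝ) - X.d₀)) *
            (((X.d₁ : ℝ) - Module.finrank ℂ T₁) + ((X.ell₁ : ℝ) -
              Module.finrank ℤ ↥(X.Y ⊓ ((T₀.prod T₁).restrictScalars ℤ ⊔ omegaLattice X.d₀ X.d₁)))) ≤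
          (X.d₁ : ℝ) * (((((X.d₀ : ℝ) - Module.finrank ℂ T₀) + ((X.d₁ : ℝ) - Module.finrank ℂ T₁)) -
              ((X.ell₀ : ℝ) - Module.finrank K ↥(X.W ⊓ (T₀.prod T₁).restrictScalars K))) +
            ε * (((X.ell₀ : ℝ) - Module.finrank K ↥(X.W ⊓ (T₀.prod T₁).restrictScalars K)) -
              ((X.d₀ : ℝ) - Module.finrank ℂ T₀)) -
            ε ^ 2 * ((X.ellA : ℝ) -
              Module.finrank ℤ ↥(X.Ya ⊓ ((T₀.prod T₁).restrictScalars ℤ ⊔ omegaLattice X.d₀ X.d₁))))) :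
    ∃ (d₀' d₁' : ℕ) (g : ((Fin X.d₀ → ℂ) × (Fin X.d₁ → ℂ)) →ₗ[ℂ] ((Fin d₀' → ℂ) × (Fin d₁' → ℂ))),
      IsStruct K g ∧ Function.Surjective g ∧
      (∀ z : Fin X.d₁ → ℤ, ∃ z' : Fin d₁' → ℤ, g (0, fun j => (z j : ℂ)) = (0, fun j => (z' j : ℂ))) ∧
      0 < d₀' + d₁' ∧
      ∀ ε : ℝ, 0 < ε → ε ≤ 1 / (2 * ((X.d₀ : ℝ) + X.d₁) * (((X.d₀ : ℝ) + X.d₁) + ((X.ell₁ : ℝ) - X.kap)) + 1) →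
        ((((X.d₀ : ℝ) + X.d₁) - 2 * X.nn) + ε * ((X.nn : ℝ) - X.d₀)) *
            ((d₁' : ℝ) + ((Module.finrank ℤ ↥(X.Y.map (g.restrictScalars ℤ)) : ℝ) -
              Module.finrank ℤ ↥(X.Y.map (g.restrictScalars ℤ) ⊓ omegaLattice d₀' d₁'))) ≤
          (X.d₁ : ℝ) * ((((d₀' : ℝ) + d₁') - Module.finrank K ↥(X.W.map (g.restrictScalars K))) +
            ε * ((Module.finrank K ↥(X.W.map (g.restrictScalars K)) : ℝ) - d₀') -
            ε ^ 2 * ((Module.finrank ℤ ↥(X.Ya.map (g.restrictScalars ℤ)) : ℝ) -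
              Module.finrank ℤ ↥(X.Ya.map (g.restrictScalars ℤ) ⊓ omegaLattice d₀' d₁'))) := by
  classical
  obtain ⟨T₀, T₁, hT₀, hT₁, hne, hineq⟩ := hsub
  obtain ⟨e, g₀, g₀K, hg₀surj, hg₀ker, hg₀K, hdim₀⟩ := exists_kQuot K T₀ hT₀
  obtain ⟨k, g₁, C, hg₁surj, hg₁ker, hg₁C, hfr₁, hk, hsat⟩ := exists_intQuot_sat T₁ hT₁
  set g : ((Fin X.d₀ → ℂ) × (Fin X.d₁ → ℂ)) →ₗ[ℂ] ((Fin e → ℂ) × (Fin (X.d₁ - k) → ℂ)) :=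
    LinearMap.prodMap g₀ g₁ with hg
  have hgap : ∀ p, g p = (g₀ p.1, g₁ p.2) := fun p => rfl
  have hstruct : IsStruct K g :=
    isStruct_of_block g g₀ g₁ hgap (fun c => ⟨g₀K c, hg₀K c⟩) (exists_rat_of_int_matrix C g₁ hg₁C)
  have hsurj : Function.Surjective g := by
    rintro ⟨u, v⟩
    obtain ⟨u', rfl⟩ := hg₀surj u
    obtain ⟨v', rfl⟩ := hg₁surj v
    exact ⟨(u', v'), rfl⟩
  have hg₁int : ∀ z : Fin X.d₁ → ℤ, g₁ (fun j => (z j : ℂ)) = fun l => ((C.mulVec z l : ℤ) : ℂ) := by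
    intro z; funext l
    rw [hg₁C]
    simp [Matrix.mulVec, dotProduct]
  have hint : ∀ z : Fin X.d₁ → ℤ, ∃ z' : Fin (X.d₁ - k) → ℤ, g (0, fun j => (z j : ℂ)) = (0, fun j => (z' j : ℂ)) :=
    fun z => ⟨C.mulVec z, by rw [hgap]; simp only [map_zero]; rw [hg₁int]⟩
  have hkerg : LinearMap.ker g = T₀.prod T₁ := by
    ext ⟨u, v⟩
    rw [LinearMap.mem_ker, hgap, Prod.mk_eq_zero, Submodule.mem_prod, ← LinearMap.mem_ker, ← LinearMap.mem_ker,
      hg₀ker, hg₁ker]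
  -- `d' > 0`
  have hdpos : 0 < e + (X.d₁ - k) := by
    rcases hne with h | h
    · have : Module.finrank ℂ T₀ < X.d₀ := by
        have := Submodule.finrank_lt h
        simpa using this
      omega
    · have : Module.finrank ℂ T₁ < X.d₁ := by
        have := Submodule.finrank_lt h
        simpa using this
      omega
  -- `ℓ₀'`
  haveI : FiniteDimensional K X.W := X.finite_W
  have hℓ₀ : (Module.finrank K ↥(X.W.map (g.restrictScalars K)) : ℝ) =
      (X.ell₀ : ℝ) - Module.finrank K ↥(X.W ⊓ (T₀.prod T₁).restrictScalars K) := by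
    have h := finrank_map_add_finrank_inf_ker_field X.W (g.restrictScalars K)
    rw [LinearMap.ker_restrictScalars, hkerg] at h
    simp only [RWObj.ell₀]
    have h' : ((Module.finrank K ↥(X.W.map (g.restrictScalars K)) +
        Module.finrank K ↥(X.W ⊓ (T₀.prod T₁).restrictScalars K) : ℕ) : ℝ) = Module.finrank K X.W := by
      exact_mod_cast h
    push_cast at h'
    linarith
  -- `λ'` and `λ_a'`: `g⁻¹(Ω') = (T₀ × T₁) + Ω`
  set M : Submodule ℤ ((Fin X.d₀ → ℂ) × (Fin X.d₁ → ℂ)) := (T₀.prod T₁).restrictScalars ℤ ⊔ omegaLattice X.d₀ X.d₁ with hM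
  have hcomap : (omegaLattice e (X.d₁ - k)).comap (g.restrictScalars ℤ) = M := by
    ext p
    rw [Submodule.mem_comap, LinearMap.restrictScalars_apply, mem_omegaLattice, hgap, hM, Submodule.mem_sup]
    constructor
    · rintro ⟨h1, h2⟩
      obtain ⟨z, t, ht, hpt⟩ := hsat p.2 h2
      refine ⟨(p.1, t), ⟨?_, ht⟩, (0, fun j => (z j : ℂ) * (2 * Real.pi * I)), ⟨rfl, fun j => ⟨z j, rfl⟩⟩, ?_⟩
      · show p.1 ∈ T₀
        rw [← hg₀ker, LinearMap.mem_ker]; exact h1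
      · ext j <;> simp [hpt, add_comm]
    · rintro ⟨y, ⟨hy1, hy2⟩, w, ⟨hw1, hw2⟩, rfl⟩
      refine ⟨?_, fun l => ?_⟩
      · simp only [Prod.fst_add, hw1, add_zero]
        rw [← LinearMap.mem_ker, hg₀ker]; exact hy1
      · choose m hm using hw2
        have hw : w.2 = fun j => (m j : ℂ) * (2 * Real.pi * I) := funext hm
        have hy0 : g₁ y.2 = 0 := by rw [← LinearMap.mem_ker, hg₁ker]; exact hy2
        simp only [Prod.snd_add, map_add, hy0, zero_add]
        refine ⟨C.mulVec m l, ?_⟩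
        rw [hw, hg₁C]
        simp only [Matrix.mulVec, dotProduct, Int.cast_sum, Int.cast_mul, Finset.sum_mul]
        refine Finset.sum_congr rfl fun j _ => by ring
  have hkerZ : LinearMap.ker (g.restrictScalars ℤ) = (T₀.prod T₁).restrictScalars ℤ := by
    rw [LinearMap.ker_restrictScalars, hkerg]
  have hkerM : LinearMap.ker (g.restrictScalars ℤ) ≤ M := by rw [hkerZ, hM]; exact le_sup_left
  have hlam : ∀ (S : Submodule ℤ ((Fin X.d₀ → ℂ) × (Fin X.d₁ → ℂ))), S.FG →
      ((Module.finrank ℤ ↥(S.map (g.restrictScalars ℤ)) : ℝ) -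
        Module.finrank ℤ ↥(S.map (g.restrictScalars ℤ) ⊓ omegaLattice e (X.d₁ - k))) =
      (Module.finrank ℤ S : ℝ) - Module.finrank ℤ ↥(S ⊓ M) := by
    intro S hS
    have r1 := finrank_map_add_finrank_inf_ker_int S hS (g.restrictScalars ℤ)
    have r2 : S.map (g.restrictScalars ℤ) ⊓ omegaLattice e (X.d₁ - k) = (S ⊓ M).map (g.restrictScalars ℤ) := by
      rw [Submodule.map_inf_eq_map_inf_comap, hcomap]
    haveI : Module.Finite ℤ S := Module.Finite.iff_fg.mpr hS
    have hSM : (S ⊓ M).FG := Module.Finite.iff_fg.mp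
      (Module.Finite.of_injective (Submodule.inclusion (inf_le_left : S ⊓ M ≤ S)) (Submodule.inclusion_injective _))
    have r3 := finrank_map_add_finrank_inf_ker_int (S ⊓ M) hSM (g.restrictScalars ℤ)
    have r4 : S ⊓ M ⊓ LinearMap.ker (g.restrictScalars ℤ) = S ⊓ LinearMap.ker (g.restrictScalars ℤ) := by
      rw [inf_assoc, inf_eq_right.mpr hkerM]
    rw [r4] at r3
    rw [r2]
    have e1 : ((Module.finrank ℤ ↥(S.map (g.restrictScalars ℤ)) + Module.finrank ℤ ↥(S ⊓ LinearMap.ker (g.restrictScalars ℤ)) : ℕ) : ℝ) =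
        Module.finrank ℤ S := by exact_mod_cast r1
    have e2 : ((Module.finrank ℤ ↥((S ⊓ M).map (g.restrictScalars ℤ)) + Module.finrank ℤ ↥(S ⊓ LinearMap.ker (g.restrictScalars ℤ)) : ℕ) : ℝ) =
        Module.finrank ℤ ↥(S ⊓ M) := by exact_mod_cast r3
    push_cast at e1 e2
    linarith
  have hY := hlam X.Y X.hYfg
  have hYa := hlam X.Ya X.fg_Ya
  -- the dimensions
  have hd₁' : ((X.d₁ - k : ℕ) : ℝ) = (X.d₁ : ℝ) - Module.finrank ℂ T₁ := by
    rw [hfr₁, Nat.cast_sub hk]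
  have hd₀' : (e : ℝ) = (X.d₀ : ℝ) - Module.finrank ℂ T₀ := by
    have : ((Module.finrank ℂ T₀ + e : ℕ) : ℝ) = X.d₀ := by exact_mod_cast hdim₀
    push_cast at this; linarith
  refine ⟨e, X.d₁ - k, g, hstruct, hsurj, hint, hdpos, fun ε hε0 hε => ?_⟩
  have H := hineq ε hε0 hε
  simp only [RWObj.ell₁, RWObj.ellA] at hY hYa H
  rw [hY, hYa, hℓ₀, hd₁', hd₀']
  simp only [RWObj.ell₀] at H ⊢
  linarith [H]

/-! ### The named fact from Théorème 5.1 in subspace form -/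

/-- **`royWaldschmidt_quadratic_thm_0_2` (Théorème 0.2) from Théorème 5.1 of the paper in subspace
form** (`h51sub`: for `K` finitely generated of transcendence degree `1` and an object
`(d₀, d₁, W, Y, Y_a)` with `d > 0`, there are `T₀ ⊆ ℂ^{d₀}` defined over `K` and `T₁ ⊆ ℂ^{d₁}`
defined over `ℚ`, not both everything — i.e. a connected algebraic subgroup `L = L₀ × L₁ ≠ G` defined
over `K` — satisfying (5.1) with the printed quantities, see the module docstring), through
`h51_of_subspaceForm` and `royWaldschmidt_quadratic_thm_0_2_of_thm_5_1`.
[cite: RoyWaldschmidt1997ENS, Théorème 5.1 p. 779, Théorème 0.2 p. 755] -/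
theorem royWaldschmidt_quadratic_thm_0_2_of_thm_5_1_subspaceForm
    (h51sub : ∀ (K : IntermediateField ℚ ℂ), K.FG → Algebra.trdeg ℚ K = 1 → ∀ X : RWObj K, 0 < X.d₀ + X.d₁ →
    ∃ (T₀ : Submodule ℂ (Fin X.d₀ → ℂ)) (T₁ : Submodule ℂ (Fin X.d₁ → ℂ)),
      IsKRational K T₀ ∧ IsKRational ℚ T₁ ∧ (T₀ ≠ ⊤ ∨ T₁ ≠ ⊤) ∧
      ∀ ε : ℝ, 0 < ε → ε ≤ 1 / (2 * ((X.d₀ : ℝ) + X.d₁) * (((X.d₀ : ℝ) + X.d₁) + ((X.ell₁ : ℝ) - X.kap)) + 1) →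
        ((((X.d₀ : ℝ) + X.d₁) - 2 * X.nn) + ε * ((X.nn : ℝ) - X.d₀)) *
            (((X.d₁ : ℝ) - Module.finrank ℂ T₁) + ((X.ell₁ : ℝ) -
              Module.finrank ℤ ↥(X.Y ⊓ ((T₀.prod T₁).restrictScalars ℤ ⊔ omegaLattice X.d₀ X.d₁)))) ≤
          (X.d₁ : ℝ) * (((((X.d₀ : ℝ) - Module.finrank ℂ T₀) + ((X.d₁ : ℝ) - Module.finrank ℂ T₁)) -
              ((X.ell₀ : ℝ) - Module.finrank K ↥(X.W ⊓ (T₀.prod T₁).restrictScalars K))) +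
            ε * (((X.ell₀ : ℝ) - Module.finrank K ↥(X.W ⊓ (T₀.prod T₁).restrictScalars K)) -
              ((X.d₀ : ℝ) - Module.finrank ℂ T₀)) -
            ε ^ 2 * ((X.ellA : ℝ) -
              Module.finrank ℤ ↥(X.Ya ⊓ ((T₀.prod T₁).restrictScalars ℤ ⊔ omegaLattice X.d₀ X.d₁))))) :
    royWaldschmidt_quadratic_thm_0_2 :=
  royWaldschmidt_quadratic_thm_0_2_of_thm_5_1 fun K hfg htr X hd =>
    h51_of_subspaceForm X (h51sub K hfg htr X hd)

end RoyWaldschmidt1997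

end Literature.NumberTheory.Transcendental
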